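import Summits.BirchSwinnertonDyer.Rank1Residual.Additive.CensusX42ValBridges
import Summits.BirchSwinnertonDyer.Rank1Residual.Additive.RankOneUpperHalfUnitRows
import HarnessLib

/-!
# Census relation X4-2 at WINDOW grade, III: unit rows of `Ш_an` — the VALUATION relation AT THE PAIR
# + the hna-free UPPER half ⟹ `BSD(E,p)` (cell `b2b-bsdres`, census cell `bsd-formula-census`, seat
# `b2b-bsdres-census-ctyper1` = conjecture-typer 1, gen 6; "(S10) × X4-2 WINDOW": team n1011 seat p16's
# `RankOneUpperHalfUnitRows.lean` (p262041) composed with `CensusX42ValBridges.lean`; the window-grade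
# twin of `CensusX42UnitRows.lean`)

HONEST FRAMING (cell `b2b-bsdres`, run/shared/lean/b2b/bsd-rank1-residual/, verbatim in every
file): the goal of the cell is to DELETE the COMBINATION-SHAPED residual classes of the
Birch–Swinnerton-Dyer formula for ALL analytic-rank `≤ 1` elliptic curves over `ℚ` — "full BSD
formula for every rank `≤ 1` curve in class `C`" assembled STRICTLY from published theorems — so
that the rank-`≤ 1` remainder becomes exactly the CONSTRUCTION-SHAPED classes, which are TYPED
(missing-input `Prop`s), NOT attempted. This is not "finishing BSD". Census cell
(bsd-formula-census): research instrumentation; census output = EVIDENCE / conjecture items, never a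
Literature fact; labels / RESIDUAL-MAP marks UNCHANGED (O7-ord OPEN; X3♯ / X4♯ CONSTRUCTION-SHAPED);
nothing booked. THEOREMS ONLY (no definition, no named fact); named facts enter as HYPOTHESES
(Gross–Zagier I.(7.3) `hGZ`, GZK `hGZK`, modularity `hmodD`; in the unit-row file also Kato 2004
Thm. 17.4 (3) `hK`, Wuthrich 2014 Thm. 16 `hWu`/`hW16`); the census relation
`CensusX42.ValRelationAt W p Dh` (`CensusX42ValRelation.lean`, `@[conjecture]`, X4-2 at WINDOW grade —
EVIDENCE: X42-REPORT.md sha256 `e8592c9a2e1a59c13e754928288c9f6b1ce554f7ffb80b93db3c55aa7f5e9950`,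
X42-WINDOW.md sha256 `a10a170979128fde17cf31b1704581a6d978f587434da820ed86243fc49ef835`) is a
HYPOTHESIS at the pair (resp. for every (B)-datum). The analytic order of `Ш` enters as a census LITERAL per row (`hs : shaAn W = s`,
`hsv : ord_p s = 0`, EVIDENCE when instantiated — `#Ш_an = 1` on every X4-2 row of record: 700/700
`N ≤ 3000`, 429/429 WINDOW).

## What

On a semistable-twist rank-ONE row of O7-ord with `p ∤ #Ш_an(E)`, seat p16's hna-free UPPER-half pinch
((S10): `ord_p #Ш ≤ ord_p #Ш_an = 0`) needs only a (B)-datum `Dh`, the Schneider rider and the typed branch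
`p`-adic Gross–Zagier; `CensusX42ValRelation` / `CensusX42ValBridges` read both off the VALUATION relation
`CensusX42.ValRelationAt W p Dh` — the X4-2 relation at the grade the WINDOW certified (valuations
only). Hence, parity-uniformly in the odd prime and with NO certificate / Λ-adic LOWER / budget /
`5 ≤ p` / anomalous proviso: `ClassX4Gord.bsdp_rankOne_of_katoHalf_of_censusX42Val_of_shaAn_unit`
(X4♯(G-ord, `e = 2`) ∩ {`ρ̄` onto}; `…three…`), `ClassX3Gord.bsdp_rankOne_of_wuthrichHalf_of_censusX42Val_of_shaAn_unit`
(no image hypothesis; `…three…`), `ClassX4M.bsdp_rankOne_of_katoHalf_of_censusX42Val_of_shaAn_unit`,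
`ClassX3M.bsdp_rankOne_of_wuthrichHalf_of_censusX42Val_of_shaAn_unit`. The exact-relation forms
(`…_of_censusX42_of_shaAn_unit`, `CensusX42UnitRows.lean`) are their corollaries through
`valRelationAt_of_relationAt`. WINDOW reach (zero-compute join of record
`HOME/b2b-bsdres-census-ctyper1/x42/WINDOW-unitrow-nodes-20260821.tsv`, sha16 `1800da1f387ccef2`):
423 / 429 window pairs carry one of these nodes (X3 rows 382 image-free; X4 rows with `ρ̄_{E,p}` onto
41); the 6 X4 rows with image `Ns` at `3` (2178h1, 10890bm1, 10890s1, 11520p1, 15210bu1, 18513i1) have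
no node at this grade (small-image class). EVIDENCE-conditional; nothing asserted about any curve;
nothing booked.

References: K. Kato, Astérisque 295 (2004) Thm. 17.4 (3) [Kato2004Asterisque]; C. Wuthrich, Doc. Math.
19 (2014) Thm. 16 [Wuthrich2014]; D. Delbourgo, Compositio Math. 113 (1998) §2.5 [Delbourgo1998];
D. Delbourgo, J. Number Theory 95 (2002) Thm. (B) [Delbourgo2002]; B. Gross, D. Zagier, Invent. Math. 84
(1986) Thm. I.(7.3) [GrossZagier1986]; R. L. Miller, LMS J. Comput. Math. 14 (2011) Def. 1.1
[Miller2011LMS]; census files of record as above.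
-/

set_option autoImplicit false

noncomputable section

open scoped Classical MatrixGroups ModularForm NumberField

open CongruenceSubgroup WeierstrassCurve NumberField Literature.NumberTheory.EllipticCurves
  Literature.NumberTheory.EllipticCurves.ModularForms
  Literature.NumberTheory.EllipticCurves.Rank1Residual
  Literature.NumberTheory.EllipticCurves.Rank1Residual.Typed
  Literature.NumberTheory.EllipticCurves.Delbourgo2002
  Literature.NumberTheory.GaloisRepresentations
  Literature.Barriers.BirchSwinnertonDyer
  IsDedekindDomain

namespace Summit.BirchSwinnertonDyer.Rank1Residual.Additive

/-! ### §1 (S10) at WINDOW grade: unit rows of `Ш_an`, the valuation relation AT THE PAIR ⟹ `BSD(E,p)` -/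

open CensusX42

variable {W : WeierstrassCurve ℚ} [W.IsElliptic] [W.IsGloballyMinimal] {p : ℕ} [hp : Fact p.Prime]

omit [W.IsElliptic] [W.IsGloballyMinimal] in
/-- An odd prime is `≡ 1` or `≡ 3 (mod 4)` (parity bookkeeping for the branch index). [folklore] -/
private theorem mod_four_eq_one_or_three' (hp2 : p ≠ 2) : p % 4 = 1 ∨ p % 4 = 3 := by
  obtain ⟨k, hk⟩ := hp.out.odd_of_ne_two hp2
  omega

/-- **X4♯(G-ord, `e = 2`) ∩ {`ρ̄_{E,p}` onto}, `r_an = 1`, EVERY odd `p`, `p ∤ #Ш_an(E)`:** Kato's half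
(`hK`) + a Delbourgo (B)-datum `Dh` (`hB`) + **the VALUATION relation at the pair for `Dh`** (`hrel`,
WINDOW grade) + GZ I.(7.3) + GZK + modularity + the unit literal (`hs`, `hsv`) ⟹ `BSD(E,p)` (seat p16's
hna-free UPPER-half pinch `…_of_shaAn_unit`, p262041). NO certificate / LOWER / budget / `5 ≤ p` /
anomalous proviso. [cite: Kato2004Asterisque, Thm. 17.4 (3) (p. 273)] [cite: Delbourgo2002, Theorem (B) (p. 40)]
[cite: Delbourgo1998, §2.5 BS-D(p) (ii) (p. 152)] [cite: GrossZagier1986, Thm. I.(7.3)] [cite: Miller2011LMS, Def. 1.1] -/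
theorem ClassX4Gord.bsdp_rankOne_of_katoHalf_of_censusX42Val_of_shaAn_unit
    (hK : Wuthrich2014.kato_halfEigenCharIdeal_dvd_cyclotomicPrime_of_surjective)
    (hGZ : GrossZagier1986_thm_I_7_3) (hGZK : rank_eq_analyticRank_of_analyticRank_le_one)
    (hmod : hasEntireLFunction_rat) (hmodD : nonempty_modularParametrizationData)
    (hX : ClassX4Gord W p) (he : semistabilityIndex W p = 2) (hsurj : Surj W p)
    (hr : W.analyticRank = 1) {Dh : PAdicHeightData W p} (hB : LeadingTermClauses W p Dh)
    (hrel : ValRelationAt W p Dh) {s : ℚ} (hs : shaAn W = (s : ℂ)) (hsv : padicValRat p s = 0) :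
    BSDp W p := by
  have hp2 : p ≠ 2 := hX.addv.1
  have hS : SchneiderConjecture Dh :=
    schneider_of_valRelationAt hGZ hGZK hmodD hp2 hX.typeGOrd hX.addv.2 he hr hrel
  rcases mod_four_eq_one_or_three' (p := p) hp2 with h1 | h3
  · exact hX.bsdp_rankOne_of_katoHalf_of_schneider_of_branchPAdicGrossZagier_of_shaAn_unit hK hGZK hmod
      hmodD he h1 hsurj hr hB hS
      (branchPAdicGrossZagierAt_of_valRelationAt hGZ hGZK W hX.addv.2 hr Dh hrel) hs hsv
  · exact hX.bsdp_rankOne_of_katoHalf_of_branchPAdicGrossZagierOdd_of_shaAn_unit hK hGZK hmod hmodD he h3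
      hsurj hr hB hS (branchPAdicGrossZagierOddAt_of_valRelationAt hGZ hGZK W hX.addv.2 hr Dh hrel) hs hsv

/-- **At `p = 3`** (`e = 2` automatic): X4♯(G-ord)@3 ∩ {`ρ̄_{E,3}` onto}, `r_an = 1`, `3 ∤ #Ш_an(E)`, the
valuation relation at the pair for a (B)-datum ⟹ `BSD(E,3)` (WINDOW: 128 Gord3 pairs at `3`, of which
the 7 X4 rows with `ρ̄` onto on 3). [cite: Kato2004Asterisque, Thm. 17.4 (3) (p. 273)]
[cite: Delbourgo1998, §2.5 BS-D(p) (ii) (p. 152)] [cite: GrossZagier1986, Thm. I.(7.3)] [cite: Miller2011LMS, Def. 1.1] -/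
theorem ClassX4Gord.bsdp_three_rankOne_of_katoHalf_of_censusX42Val_of_shaAn_unit
    [Fact (Nat.Prime 3)] {W : WeierstrassCurve ℚ} [W.IsElliptic] [W.IsGloballyMinimal]
    (hK : Wuthrich2014.kato_halfEigenCharIdeal_dvd_cyclotomicPrime_of_surjective)
    (hGZ : GrossZagier1986_thm_I_7_3) (hGZK : rank_eq_analyticRank_of_analyticRank_le_one)
    (hmod : hasEntireLFunction_rat) (hmodD : nonempty_modularParametrizationData)
    (hX : ClassX4Gord W 3) (hsurj : Surj W 3) (hr : W.analyticRank = 1) {Dh : PAdicHeightData W 3}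
    (hB : LeadingTermClauses W 3 Dh) (hrel : ValRelationAt W 3 Dh) {s : ℚ} (hs : shaAn W = (s : ℂ))
    (hsv : padicValRat 3 s = 0) : BSDp W 3 :=
  hX.bsdp_rankOne_of_katoHalf_of_censusX42Val_of_shaAn_unit hK hGZ hGZK hmod hmodD
    (semistabilityIndex_eq_two_of_typeG_three W hX.typeGOrd.typeG hX.addv.2) hsurj hr hB hrel hs hsv

/-- **X3♯(G-ord, `e = 2`) (reducible `E[p]`; NO image hypothesis), `r_an = 1`, EVERY odd `p`,
`p ∤ #Ш_an(E)`:** Wuthrich's Thm. 16 half + a (B)-datum + **the valuation relation at the pair** + GZ +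
GZK + modularity + the unit literal ⟹ `BSD(E,p)` (WINDOW: the 121 + 13 reducible (G-ord) rows).
[cite: Wuthrich2014, Thm. 16 (p. 397)] [cite: Delbourgo1998, §2.5 BS-D(p) (ii) (p. 152)]
[cite: GrossZagier1986, Thm. I.(7.3)] [cite: Miller2011LMS, Def. 1.1] -/
theorem ClassX3Gord.bsdp_rankOne_of_wuthrichHalf_of_censusX42Val_of_shaAn_unit
    (hWu : Wuthrich2014.thm16_halfEigenCharIdeal_dvd_cyclotomicPrime)
    (hGZ : GrossZagier1986_thm_I_7_3) (hGZK : rank_eq_analyticRank_of_analyticRank_le_one)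
    (hmod : hasEntireLFunction_rat) (hmodD : nonempty_modularParametrizationData)
    (hX : ClassX3Gord W p) (hp2 : p ≠ 2) (he : semistabilityIndex W p = 2) (hr : W.analyticRank = 1)
    {Dh : PAdicHeightData W p} (hB : LeadingTermClauses W p Dh) (hrel : ValRelationAt W p Dh)
    {s : ℚ} (hs : shaAn W = (s : ℂ)) (hsv : padicValRat p s = 0) : BSDp W p := by
  have hS : SchneiderConjecture Dh :=
    schneider_of_valRelationAt hGZ hGZK hmodD hp2 hX.typeGOrd hX.addv he hr hrel
  rcases mod_four_eq_one_or_three' (p := p) hp2 with h1 | h3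
  · exact hX.bsdp_rankOne_of_wuthrichHalf_of_schneider_of_branchPAdicGrossZagier_of_shaAn_unit hWu hGZK
      hmod hmodD he h1 hr hB hS (branchPAdicGrossZagierAt_of_valRelationAt hGZ hGZK W hX.addv hr Dh hrel)
      hs hsv
  · exact hX.bsdp_rankOne_of_wuthrichHalf_of_branchPAdicGrossZagierOdd_of_shaAn_unit hWu hGZK hmod hmodD
      he h3 hr hB hS (branchPAdicGrossZagierOddAt_of_valRelationAt hGZ hGZK W hX.addv hr Dh hrel) hs hsv

/-- **At `p = 3`**: X3♯(G-ord)@3, `r_an = 1`, `3 ∤ #Ш_an(E)`, the valuation relation at the pair ⟹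
`BSD(E,3)` from Wuthrich's half (no image hypothesis; `e = 2` automatic).
[cite: Wuthrich2014, Thm. 16 (p. 397)] [cite: GrossZagier1986, Thm. I.(7.3)] [cite: Miller2011LMS, Def. 1.1] -/
theorem ClassX3Gord.bsdp_three_rankOne_of_wuthrichHalf_of_censusX42Val_of_shaAn_unit
    [Fact (Nat.Prime 3)] {W : WeierstrassCurve ℚ} [W.IsElliptic] [W.IsGloballyMinimal]
    (hWu : Wuthrich2014.thm16_halfEigenCharIdeal_dvd_cyclotomicPrime)
    (hGZ : GrossZagier1986_thm_I_7_3) (hGZK : rank_eq_analyticRank_of_analyticRank_le_one)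
    (hmod : hasEntireLFunction_rat) (hmodD : nonempty_modularParametrizationData)
    (hX : ClassX3Gord W 3) (hr : W.analyticRank = 1) {Dh : PAdicHeightData W 3}
    (hB : LeadingTermClauses W 3 Dh) (hrel : ValRelationAt W 3 Dh) {s : ℚ} (hs : shaAn W = (s : ℂ))
    (hsv : padicValRat 3 s = 0) : BSDp W 3 :=
  hX.bsdp_rankOne_of_wuthrichHalf_of_censusX42Val_of_shaAn_unit hWu hGZ hGZK hmod hmodD (by norm_num)
    (semistabilityIndex_eq_two_of_typeG_three W hX.typeGOrd.typeG hX.addv) hr hB hrel hs hsv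

end Summit.BirchSwinnertonDyer.Rank1Residual.Additive

namespace Summit.BirchSwinnertonDyer.Rank1Residual.AdditivePotMult

open Additive CensusX42

variable {W : WeierstrassCurve ℚ} [W.IsElliptic] [W.IsGloballyMinimal] {p : ℕ} [hp : Fact p.Prime]

/-- **X4(M) ∩ {`ρ̄_{E,p}` onto}, `r_an = 1`, EVERY odd `p` (incl. `3`), `p ∤ #Ш_an(E)`:** Kato's half + a
(B)-datum + **the valuation relation at the pair** (rider `schneider_of_valRelationAt_mult`, typed (M) GZ
`branchPAdicGrossZagierMultAt_of_valRelationAt`) + GZ + GZK + modularity + the unit literal ⟹ `BSD(E,p)`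
(WINDOW: the 34 + 3 (M) X4 rows with `ρ̄` onto; the X3 (M) rows are the `ClassX3M` theorem's).
[cite: Kato2004Asterisque, Thm. 17.4 (3) (p. 273)] [cite: Delbourgo1998, §2.5 BS-D(p) (ii) (p. 152)]
[cite: GrossZagier1986, Thm. I.(7.3)] [cite: MazurTateTeitelbaum1986Invent, §I.10, §I.13] [cite: Miller2011LMS, Def. 1.1] -/
theorem ClassX4M.bsdp_rankOne_of_katoHalf_of_censusX42Val_of_shaAn_unit
    (hK : Wuthrich2014.kato_halfEigenCharIdeal_dvd_cyclotomicPrime_of_surjective)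
    (hGZ : GrossZagier1986_thm_I_7_3) (hGZK : rank_eq_analyticRank_of_analyticRank_le_one)
    (hmod : hasEntireLFunction_rat) (hmodD : nonempty_modularParametrizationData)
    (hX : ClassX4M W p) (hsurj : Surj W p) (hr : W.analyticRank = 1) {Dh : PAdicHeightData W p}
    (hB : LeadingTermClauses W p Dh) (hrel : ValRelationAt W p Dh) {s : ℚ} (hs : shaAn W = (s : ℂ))
    (hsv : padicValRat p s = 0) : BSDp W p :=
  hX.bsdp_rankOne_of_katoHalf_of_branchPAdicGrossZagierMult_of_shaAn_unit hK hGZK hmod hmodD hsurj hr hB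
    (schneider_of_valRelationAt_mult hGZ hGZK hmodD hX.p_ne_two (ClassX4M.potMult W p hX) hr hrel)
    (branchPAdicGrossZagierMultAt_of_valRelationAt hGZ hGZK W hX.classX4.2.1 hr Dh hrel) hs hsv

/-- **X3♯(M) (reducible `E[p]`; NO image / tower / CM / anomalous binder), `r_an = 1`, EVERY odd `p`,
`p ∤ #Ш_an(E)`:** Wuthrich's half + a (B)-datum + **the valuation relation at the pair** + GZ + GZK +
modularity + the unit literal ⟹ `BSD(E,p)` (WINDOW: the 233 + 15 reducible (M) rows).
[cite: Wuthrich2014, Thm. 16 (p. 397)] [cite: Delbourgo1998, §2.5 BS-D(p) (ii) (p. 152)]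
[cite: GrossZagier1986, Thm. I.(7.3)] [cite: Miller2011LMS, Def. 1.1] -/
theorem ClassX3M.bsdp_rankOne_of_wuthrichHalf_of_censusX42Val_of_shaAn_unit
    (hW16 : Wuthrich2014.thm16_halfEigenCharIdeal_dvd_cyclotomicPrime)
    (hGZ : GrossZagier1986_thm_I_7_3) (hGZK : rank_eq_analyticRank_of_analyticRank_le_one)
    (hmod : hasEntireLFunction_rat) (hmodD : nonempty_modularParametrizationData)
    (hX : ClassX3M W p) (hr : W.analyticRank = 1) {Dh : PAdicHeightData W p}
    (hB : LeadingTermClauses W p Dh) (hrel : ValRelationAt W p Dh) {s : ℚ} (hs : shaAn W = (s : ℂ))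
    (hsv : padicValRat p s = 0) : BSDp W p :=
  hX.bsdp_rankOne_of_wuthrichHalf_of_branchPAdicGrossZagierMult_of_shaAn_unit hW16 hGZK hmod hmodD hr hB
    (schneider_of_valRelationAt_mult hGZ hGZK hmodD hX.p_ne_two hX.potMult hr hrel)
    (branchPAdicGrossZagierMultAt_of_valRelationAt hGZ hGZK W hX.potMult.1 hr Dh hrel) hs hsv

end Summit.BirchSwinnertonDyer.Rank1Residual.AdditivePotMult

end
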